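import Literature.Analysis.FluidPDE.PassiveVectorTensorModalAdjointCoeff
import Literature.Analysis.FluidPDE.PassiveVectorTensorDistorted
import HarnessLib

/-!
# The Leray projection at a REAL wave vector and the plane-wave symbol of a CONJUGATED tensor
# (the fibre geometry of the frozen-frame / constant-distortion passive-vector problem)

Analysis/FluidPDE support file (four small definitions with bodies + proved lemmas; no named facts).

A constant volume-preserving change of frame `G₀` (Armstrong–Vicol's Lagrangian-coordinate ansatz,
arXiv:2305.05048 §4.1, with the distortion frozen) acts on the fixed-lattice passive-vector problem only
through the FIBRE geometry at each integer wave vector `k ∈ ℤ^d`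
(`PassiveVectorTensorDistortedConstFrameFourier`): the solenoidality plane `k^⊥` becomes the plane
orthogonal to the TWISTED (real) frequency `G₀ᵀk`, and the plane-wave symbol matrix becomes that of the
conjugated tensor `𝔸^{G₀} = Visc4.conj G₀ 𝔸`, which is `T_𝔸` evaluated at `G₀ᵀk`.  This file supplies
the two elementary objects every mode-by-mode argument on that problem needs, as REAL-wave-vector twins of
`PassiveVectorTensorModalAdjointCoeff` §1 (`waveVecC / kdot / transversalProj`, integer `k`):

* §1 `waveVecRC q`, `rdot q`, `transversalProjR q` — the real wave vector `q : d → ℝ` in `ℂ^d`, the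
  divergence pairing `q · z`, and the Leray projection `P_q z = z − (q·z/|q|²) q` with its algebra
  (transversal range, fixes transversal vectors, self-adjoint, idempotent, Pythagoras
  `‖P_q z‖² = ‖z‖² − |q·z|²/|q|²`, `‖P_q z‖ ≤ ‖z‖`, `P_q q = 0`), and the consistency
  `transversalProjR (k : ℝ^d) = transversalProj k` with the integer file;
* §2 `twistFreq G₀ k = (k : ℝ^d) ᵥ* G₀ = G₀ᵀk` — the twisted frequency of the integer mode `k`
  (`twistFreq 1 k = k`), and its pairing `rdot (twistFreq G₀ k) z = Σ_b (Σ_a k_a G₀ab) z_b` in the form used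
  by `…DistortedConstFrameFourier`;
* §3 the symbol of the conjugated tensor: `σ_{𝔸^{M}}(ξ, p) = σ_𝔸(Mᵀξ, p)` (`symb_conj`), hence
  `Re ⟪z, T_{𝔸^{M}}(k) z⟫ = σ_𝔸(Mᵀk, Re z) + σ_𝔸(Mᵀk, Im z)` and, in a Legendre–Hadamard window
  `NearIso 𝔸 lo hi`, for `z` transversal to `Mᵀk`:
  `lo |Mᵀk|² ‖z‖² ≤ Re ⟪z, T_{𝔸^{M}}(k) z⟫ ≤ hi |Mᵀk|² ‖z‖²` (`lo_mul_le_re_inner_symbT_conj`,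
  `re_inner_symbT_conj_le`) — the conjugated tensor is coercive on the TWISTED plane (it is in general NOT
  `NearIso` for the flat plane).

Consumer: cell `ad-ideate`, route `SolenoidalFractalHomogenisation`, K1L_D stmt-AnomalousDissipation-27980,
registered stub `stub_D1_V0θg` (the graded frozen-frame cell law `VmodDist.SlowVectorClauseFθg`): the
twisted sideband chain replaces `transversalProj k` / `symbT 𝔹 k` by `transversalProjR (twistFreq G₀ k)` /
`symbT (Visc4.conj G₀ 𝔹) k` throughout.  NOT here: the modal generator / adjoint coefficient curve twins
(§2–§3 of the integer file), which follow the same pattern when needed.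

## Mathlib / tree search

Tree: `PassiveVectorTensorModalAdjointCoeff` (`waveVecC`, `kdot`, `transversalProj`, integer `k`; the
Summit files `…W7ThreeModeFibre` / `…W7DrainFloor` / `…CellChainFastEnergy` hold the idempotent /
self-adjoint / Pythagoras / norm lemmas for integer `k`, mirrored here for real `q`), `PassiveVectorTensor`
(`symb`, `NearIso` — stated for REAL `k p`, which is what makes §3 a one-liner),
`PassiveVectorTensorUniqueness` (`re_inner_symbT_eq`), `PassiveVectorTensorDistorted` (`Visc4.conj`).
Mathlib: `Matrix.vecMul`; the orthogonal-projection API (`Submodule.starProjection`) is deliberately not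
used, to keep the coordinate formula of the integer file (ports of its consumers are then mechanical).
`rg "transversalProj" Literature`: integer wave vectors only (2026-08-29).

## References

* R. Temam, *Navier–Stokes Equations* (AMS Chelsea 1984/2001), Ch. III §1.1 (Fourier characterisation of
  solenoidal periodic fields, the Leray symbol). [`Temam1984`]
* S. Armstrong, V. Vicol, *Anomalous diffusion by fractal homogenization*, Ann. PDE 11 (2025) /
  arXiv:2305.05048, §4.1 (PDF p. 34: the frozen distortion `s_{m−1}`). [`ArmstrongVicol2025`]
* M. Giaquinta, *Multiple integrals in the calculus of variations and nonlinear elliptic systems*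
  (Princeton 1983), Ch. III §2 (2.1)–(2.2) (Legendre–Hadamard). [`Giaquinta1983MultipleIntegrals`]
* U. Frisch, *Turbulence* (CUP 1995), §9.6.3 eq. (9.57) p. 233. [`Frisch1995Turbulence`]
-/

noncomputable section

open MeasureTheory Set Filter Complex
open scoped InnerProductSpace ComplexConjugate NNReal

namespace Literature.Analysis.FluidPDE

namespace Torus

variable {d : Type*} [Fintype d] [DecidableEq d]

/-! ## §1 The Leray projection at a real wave vector -/

/-- The real wave vector `q` as a vector of `ℂ^d`. [cite: Temam1984, Ch. III §1.1] -/
def waveVecRC (q : d → ℝ) : EuclideanSpace ℂ d := WithLp.toLp 2 fun j => ((q j : ℝ) : ℂ)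

omit [Fintype d] [DecidableEq d] in
/-- Coordinates of `waveVecRC`. [cite: Temam1984, Ch. III §1.1] -/
@[simp] theorem waveVecRC_apply (q : d → ℝ) (j : d) : waveVecRC q j = ((q j : ℝ) : ℂ) := rfl

/-- The Fourier-side divergence pairing with a real wave vector, `q · z = Σⱼ qⱼ zⱼ`, as a `ℂ`-linear
functional. [cite: Temam1984, Ch. III §1.1] -/
def rdot (q : d → ℝ) : EuclideanSpace ℂ d →ₗ[ℂ] ℂ where
  toFun z := ∑ j, ((q j : ℝ) : ℂ) * z j
  map_add' z w := by simp only [PiLp.add_apply, mul_add, Finset.sum_add_distrib]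
  map_smul' μ z := by
    simp only [PiLp.smul_apply, smul_eq_mul, RingHom.id_apply, Finset.mul_sum]
    exact Finset.sum_congr rfl fun j _ => by ring

omit [DecidableEq d] in
/-- Unfolding `rdot`. [cite: Temam1984, Ch. III §1.1] -/
theorem rdot_apply (q : d → ℝ) (z : EuclideanSpace ℂ d) : rdot q z = ∑ j, ((q j : ℝ) : ℂ) * z j := rfl

omit [DecidableEq d] in
/-- `q · q = |q|²`. [cite: Temam1984, Ch. III §1.1] -/
theorem rdot_waveVecRC (q : d → ℝ) : rdot q (waveVecRC q) = ((∑ j, q j ^ 2 : ℝ) : ℂ) := by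
  rw [rdot_apply]
  push_cast
  exact Finset.sum_congr rfl fun j _ => by rw [waveVecRC_apply]; ring

omit [DecidableEq d] in
/-- `|q|² > 0` for `q ≠ 0`. [cite: Temam1984, Ch. III §1.1] -/
theorem sum_sq_pos_of_ne_zero {q : d → ℝ} (hq : q ≠ 0) : 0 < ∑ j, q j ^ 2 := by
  obtain ⟨i, hi⟩ : ∃ i, q i ≠ 0 := by
    by_contra h
    push Not at h
    exact hq (funext h)
  have h1 : (0 : ℝ) < q i ^ 2 := by positivity
  exact lt_of_lt_of_le h1 (Finset.single_le_sum (f := fun j => q j ^ 2) (fun j _ => sq_nonneg _) (Finset.mem_univ i))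

omit [DecidableEq d] in
/-- `|q|² ≥ 0`. [cite: Temam1984, Ch. III §1.1] -/
theorem sum_sq_nonneg' (q : d → ℝ) : 0 ≤ ∑ j, q j ^ 2 := Finset.sum_nonneg fun _ _ => sq_nonneg _

/-- **The transversal (Leray) projection at the real wave vector `q`**: `P_q z = z − (q·z / |q|²) q`, the
orthogonal projection of `ℂ^d` onto `q^⊥ = {q · z = 0}` (for `q ≠ 0`; for `q = 0` it is the identity since
`|q|² = 0` makes the correction vanish).  Real-vector twin of `transversalProj`. [cite: Temam1984, Ch. III §1.1] -/
def transversalProjR (q : d → ℝ) : EuclideanSpace ℂ d →L[ℂ] EuclideanSpace ℂ d :=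
  LinearMap.toContinuousLinearMap
    (LinearMap.id - ((LinearMap.lsmul ℂ (EuclideanSpace ℂ d)).flip (waveVecRC q)).comp
      ((((∑ j, q j ^ 2 : ℝ) : ℂ)⁻¹) • rdot q))

omit [DecidableEq d] in
/-- Unfolding `transversalProjR`: `P_q z = z − ((q·z) / |q|²) • q`. [cite: Temam1984, Ch. III §1.1] -/
theorem transversalProjR_apply (q : d → ℝ) (z : EuclideanSpace ℂ d) :
    transversalProjR q z = z - ((((∑ j, q j ^ 2 : ℝ) : ℂ))⁻¹ * rdot q z) • waveVecRC q := by
  simp [transversalProjR]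

omit [DecidableEq d] in
/-- `P_q` maps into the transversal subspace: `q · (P_q z) = 0` (`q ≠ 0`). [cite: Temam1984, Ch. III §1.1] -/
theorem rdot_transversalProjR {q : d → ℝ} (hq : q ≠ 0) (z : EuclideanSpace ℂ d) :
    rdot q (transversalProjR q z) = 0 := by
  have hK : ((∑ j, q j ^ 2 : ℝ) : ℂ) ≠ 0 := by
    exact_mod_cast (sum_sq_pos_of_ne_zero hq).ne'
  rw [transversalProjR_apply, map_sub, map_smul, rdot_waveVecRC, smul_eq_mul]
  field_simp
  ring

omit [DecidableEq d] in
/-- `P_q` fixes transversal vectors: `q · z = 0 ⇒ P_q z = z`. [cite: Temam1984, Ch. III §1.1] -/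
theorem transversalProjR_eq_self_of_rdot_eq_zero (q : d → ℝ) {z : EuclideanSpace ℂ d} (hz : rdot q z = 0) :
    transversalProjR q z = z := by
  rw [transversalProjR_apply, hz, mul_zero, zero_smul, sub_zero]

omit [DecidableEq d] in
/-- `⟪q, w⟫_ℂ = q · w` for the real wave vector. [cite: Temam1984, Ch. III §1.1] -/
theorem inner_waveVecRC_left (q : d → ℝ) (w : EuclideanSpace ℂ d) : ⟪waveVecRC q, w⟫_ℂ = rdot q w := by
  rw [PiLp.inner_apply, rdot_apply]
  refine Finset.sum_congr rfl fun j _ => ?_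
  rw [RCLike.inner_apply, waveVecRC_apply]
  show w j * conj (((q j : ℝ) : ℂ)) = _
  rw [Complex.conj_ofReal, mul_comm]

omit [DecidableEq d] in
/-- On transversal vectors the projection is invisible in the pairing: `q · z = 0 ⇒ ⟪z, P_q w⟫ = ⟪z, w⟫`.
[cite: Temam1984, Ch. III §1.1] -/
theorem inner_transversalProjR_right_of_rdot_eq_zero (q : d → ℝ) {z : EuclideanSpace ℂ d} (hz : rdot q z = 0)
    (w : EuclideanSpace ℂ d) : ⟪z, transversalProjR q w⟫_ℂ = ⟪z, w⟫_ℂ := by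
  rw [transversalProjR_apply, inner_sub_right, inner_smul_right]
  have h : ⟪z, waveVecRC q⟫_ℂ = 0 := by
    rw [← inner_conj_symm, inner_waveVecRC_left, hz, map_zero]
  rw [h, mul_zero, sub_zero]

omit [DecidableEq d] in
/-- Symmetrically: `q · z = 0 ⇒ ⟪P_q w, z⟫ = ⟪w, z⟫`. [cite: Temam1984, Ch. III §1.1] -/
theorem inner_transversalProjR_left_of_rdot_eq_zero (q : d → ℝ) {z : EuclideanSpace ℂ d} (hz : rdot q z = 0)
    (w : EuclideanSpace ℂ d) : ⟪transversalProjR q w, z⟫_ℂ = ⟪w, z⟫_ℂ := by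
  rw [← inner_conj_symm, inner_transversalProjR_right_of_rdot_eq_zero q hz, inner_conj_symm]

omit [DecidableEq d] in
/-- `P_q` is self-adjoint. [cite: Temam1984, Ch. III §1.1] -/
theorem inner_transversalProjR_comm (q : d → ℝ) (x z : EuclideanSpace ℂ d) :
    ⟪transversalProjR q x, z⟫_ℂ = ⟪x, transversalProjR q z⟫_ℂ := by
  have hxK : ⟪x, waveVecRC q⟫_ℂ = conj (rdot q x) := by
    rw [← inner_conj_symm, inner_waveVecRC_left]
  have hKz : ⟪waveVecRC q, z⟫_ℂ = rdot q z := inner_waveVecRC_left q z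
  have hr : conj ((((∑ j, q j ^ 2 : ℝ) : ℂ))⁻¹) = (((∑ j, q j ^ 2 : ℝ) : ℂ))⁻¹ := by
    rw [map_inv₀, Complex.conj_ofReal]
  rw [transversalProjR_apply, transversalProjR_apply, inner_sub_left, inner_sub_right, inner_smul_left,
    inner_smul_right, hxK, hKz, map_mul, hr]
  ring

omit [DecidableEq d] in
/-- `P_q` is idempotent. [cite: Temam1984, Ch. III §1.1] -/
theorem transversalProjR_idem (q : d → ℝ) (x : EuclideanSpace ℂ d) :
    transversalProjR q (transversalProjR q x) = transversalProjR q x := by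
  by_cases hq : q = 0
  · subst hq
    simp [transversalProjR_apply]
  · exact transversalProjR_eq_self_of_rdot_eq_zero q (rdot_transversalProjR hq x)

omit [DecidableEq d] in
/-- `P_q` kills the wave vector itself: `P_q q = 0`. [cite: Temam1984, Ch. III §1.1] -/
theorem transversalProjR_waveVecRC (q : d → ℝ) : transversalProjR q (waveVecRC q) = 0 := by
  by_cases hq : q = 0
  · subst hq
    have : waveVecRC (0 : d → ℝ) = 0 := by ext j; simp
    rw [this, map_zero]
  · have hK : ((∑ j, q j ^ 2 : ℝ) : ℂ) ≠ 0 := by exact_mod_cast (sum_sq_pos_of_ne_zero hq).ne'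
    rw [transversalProjR_apply, rdot_waveVecRC, inv_mul_cancel₀ hK, one_smul, sub_self]

omit [DecidableEq d] in
/-- `‖q‖² = |q|²` for the real wave vector seen in `ℂ^d`. [cite: Temam1984, Ch. III §1.1] -/
theorem norm_waveVecRC_sq (q : d → ℝ) : ‖waveVecRC q‖ ^ 2 = ∑ j, q j ^ 2 := by
  rw [EuclideanSpace.norm_sq_eq]
  refine Finset.sum_congr rfl fun j _ => ?_
  rw [waveVecRC_apply, Complex.norm_real, Real.norm_eq_abs, sq_abs]

omit [DecidableEq d] in
/-- **Pythagoras for the Leray projection**: `‖P_q z‖² = ‖z‖² − |q·z|²/|q|²` (for `q = 0`, `P_0 = id` and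
`x/0 = 0`). [cite: Temam1984, Ch. III §1.1] -/
theorem norm_sq_transversalProjR (q : d → ℝ) (z : EuclideanSpace ℂ d) :
    ‖transversalProjR q z‖ ^ 2 = ‖z‖ ^ 2 - ‖rdot q z‖ ^ 2 / ∑ j, q j ^ 2 := by
  by_cases hq : q = 0
  · subst hq
    simp [transversalProjR_apply]
  have hF : 0 < ∑ j, q j ^ 2 := sum_sq_pos_of_ne_zero hq
  have hFC : ((∑ j, q j ^ 2 : ℝ) : ℂ) ≠ 0 := by exact_mod_cast hF.ne'
  set c : ℂ := (((∑ j, q j ^ 2 : ℝ) : ℂ))⁻¹ * rdot q z with hc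
  have hdec : z = transversalProjR q z + c • waveVecRC q := by
    rw [transversalProjR_apply]; abel
  have horth : ⟪transversalProjR q z, c • waveVecRC q⟫_ℂ = 0 := by
    rw [inner_smul_right, ← inner_conj_symm, inner_waveVecRC_left, rdot_transversalProjR hq, map_zero, mul_zero]
  have hpy : ‖z‖ ^ 2 = ‖transversalProjR q z‖ ^ 2 + ‖c • waveVecRC q‖ ^ 2 := by
    conv_lhs => rw [hdec]
    have h := @norm_add_sq_eq_norm_sq_add_norm_sq_of_inner_eq_zero ℂ _ _ _ _ _ _ horth
    simpa only [sq] using h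
  have hcv : ‖c • waveVecRC q‖ ^ 2 = ‖rdot q z‖ ^ 2 / ∑ j, q j ^ 2 := by
    rw [norm_smul, mul_pow, norm_waveVecRC_sq, hc, norm_mul, norm_inv, Complex.norm_real, Real.norm_eq_abs,
      abs_of_pos hF]
    field_simp
  rw [hpy, hcv]; ring

omit [DecidableEq d] in
/-- `‖P_q z‖ ≤ ‖z‖` (orthogonal projection). [cite: Temam1984, Ch. III §1.1] -/
theorem norm_transversalProjR_le (q : d → ℝ) (z : EuclideanSpace ℂ d) : ‖transversalProjR q z‖ ≤ ‖z‖ := by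
  have h := norm_sq_transversalProjR q z
  have h1 : ‖transversalProjR q z‖ ^ 2 ≤ ‖z‖ ^ 2 := by
    rw [h]
    have : 0 ≤ ‖rdot q z‖ ^ 2 / ∑ j, q j ^ 2 := div_nonneg (sq_nonneg _) (sum_sq_nonneg' q)
    linarith
  exact (pow_le_pow_iff_left₀ (norm_nonneg _) (norm_nonneg _) two_ne_zero).1 h1

omit [DecidableEq d] in
/-- `‖P_q‖ ≤ 1`. [cite: Temam1984, Ch. III §1.1] -/
theorem opNorm_transversalProjR_le (q : d → ℝ) : ‖transversalProjR q‖ ≤ 1 :=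
  ContinuousLinearMap.opNorm_le_bound _ zero_le_one fun z => by rw [one_mul]; exact norm_transversalProjR_le q z

omit [DecidableEq d] in
/-- Consistency with the integer file: at an integer wave vector the real projection IS `transversalProj`
(`waveVecRC (k : ℝ^d) = waveVecC k`, `rdot (k : ℝ^d) = kdot k`, `Σ (k_j : ℝ)² = freqNormSq k`).
[cite: Temam1984, Ch. III §1.1] -/
theorem transversalProjR_intCast (k : d → ℤ) : transversalProjR (fun j => (k j : ℝ)) = transversalProj k := by
  have h1 : waveVecRC (fun j => (k j : ℝ)) = waveVecC k := by
    ext j; rw [waveVecRC_apply, waveVecC_apply]; norm_cast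
  have h2 : ∀ z, rdot (fun j => (k j : ℝ)) z = kdot k z := fun z => by
    rw [rdot_apply, kdot_apply]
    exact Finset.sum_congr rfl fun j _ => by norm_cast
  have h3 : ((∑ j, (fun j => (k j : ℝ)) j ^ 2 : ℝ) : ℂ) = (FunctionSpaces.Torus.freqNormSq k : ℂ) := by
    rw [FunctionSpaces.Torus.freqNormSq]
  ext z j
  rw [transversalProjR_apply, transversalProj_apply, h1, h2, h3]

omit [DecidableEq d] in
/-- Transversality to a real wave vector passes to the real and imaginary parts:
`q · z = 0 ⇒ Σ (Re z)_i q_i = 0 ∧ Σ (Im z)_i q_i = 0`. [cite: Temam1984, Ch. III §1.1] -/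
theorem sum_re_mul_eq_zero_of_rdot_eq_zero {q : d → ℝ} {z : EuclideanSpace ℂ d} (hz : rdot q z = 0) :
    ∑ i, (z i).re * q i = 0 ∧ ∑ i, (z i).im * q i = 0 := by
  rw [rdot_apply] at hz
  have hre := congrArg Complex.re hz
  have him := congrArg Complex.im hz
  rw [Complex.re_sum, Complex.zero_re] at hre
  rw [Complex.im_sum, Complex.zero_im] at him
  constructor
  · rw [← hre]
    exact Finset.sum_congr rfl fun i _ => by rw [Complex.re_ofReal_mul]; ring
  · rw [← him]
    exact Finset.sum_congr rfl fun i _ => by rw [Complex.im_ofReal_mul]; ring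

/-! ## §2 The twisted frequency of an integer mode under a constant frame -/

/-- **The twisted frequency** of the integer mode `k` under the constant frame `G₀`:
`twistFreq G₀ k = (k : ℝ^d) ᵥ* G₀ = G₀ᵀk`, `(twistFreq G₀ k)_b = Σ_a k_a G₀ab` — the real covector along which
the frozen-frame solenoidality constraint `∇·(G₀ w) = 0` tests the mode `k` (`PassiveVectorTensorDistortedConstFrameFourier`
§5). [cite: ArmstrongVicol2025, §4.1 (PDF p. 34)] -/
def twistFreq (G₀ : Matrix d d ℝ) (k : d → ℤ) : d → ℝ := Matrix.vecMul (fun a => (k a : ℝ)) G₀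

omit [DecidableEq d] in
/-- Coordinates of the twisted frequency. [cite: ArmstrongVicol2025, §4.1 (PDF p. 34)] -/
theorem twistFreq_apply (G₀ : Matrix d d ℝ) (k : d → ℤ) (b' : d) : twistFreq G₀ k b' = ∑ a, (k a : ℝ) * G₀ a b' := by
  simp only [twistFreq, Matrix.vecMul, dotProduct]

omit [DecidableEq d] in
/-- `twistFreq G₀ k = Matrix.vecMul (k : ℝ^d) G₀` (the form used in `…DistortedConstFrameFourier`). [cite: ArmstrongVicol2025, §4.1 (PDF p. 34)] -/
theorem twistFreq_eq_vecMul (G₀ : Matrix d d ℝ) (k : d → ℤ) : twistFreq G₀ k = Matrix.vecMul (fun a => (k a : ℝ)) G₀ := rfl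

/-- The identity frame does not twist: `twistFreq 1 k = k`. [cite: ArmstrongVicol2025, §4.1 (PDF p. 34)] -/
@[simp] theorem twistFreq_one (k : d → ℤ) : twistFreq (1 : Matrix d d ℝ) k = fun a => (k a : ℝ) := by
  funext b'
  simp [twistFreq]

omit [DecidableEq d] in
/-- The pairing with the twisted frequency, unfolded: `rdot (twistFreq G₀ k) z = Σ_b ((k ᵥ* G₀)_b : ℂ) z_b`.
[cite: ArmstrongVicol2025, §4.1 (PDF p. 34)] -/
theorem rdot_twistFreq (G₀ : Matrix d d ℝ) (k : d → ℤ) (z : EuclideanSpace ℂ d) :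
    rdot (twistFreq G₀ k) z = ∑ b', ((Matrix.vecMul (fun a => (k a : ℝ)) G₀ b' : ℝ) : ℂ) * z b' := rfl

omit [DecidableEq d] in
/-- Additivity of the twisted frequency in the mode (it is linear in `k`). [cite: ArmstrongVicol2025, §4.1 (PDF p. 34)] -/
theorem twistFreq_add (G₀ : Matrix d d ℝ) (k k' : d → ℤ) : twistFreq G₀ (k + k') = twistFreq G₀ k + twistFreq G₀ k' := by
  funext b'
  simp only [twistFreq_apply, Pi.add_apply, Int.cast_add, add_mul, Finset.sum_add_distrib]

omit [DecidableEq d] in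
/-- The twisted frequency is odd in the mode. [cite: ArmstrongVicol2025, §4.1 (PDF p. 34)] -/
theorem twistFreq_neg (G₀ : Matrix d d ℝ) (k : d → ℤ) : twistFreq G₀ (-k) = -twistFreq G₀ k := by
  funext b'
  simp only [twistFreq_apply, Pi.neg_apply, Int.cast_neg, neg_mul, Finset.sum_neg_distrib]

/-! ## §3 The plane-wave symbol of a conjugated tensor -/

omit [DecidableEq d] in
/-- Reindexing of a six-fold finite sum: `Σ_i Σ_c Σ_j Σ_e Σ_a Σ_b g(i,a,j,b,c,e) = Σ_i Σ_a Σ_j Σ_b Σ_c Σ_e g(i,a,j,b,c,e)`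
(bookkeeping for `symb_conj`). [folklore] -/
private theorem sum6_reindex (g : d → d → d → d → d → d → ℝ) :
    ∑ i, ∑ c, ∑ j, ∑ e, ∑ a, ∑ b, g i a j b c e = ∑ i, ∑ a, ∑ j, ∑ b, ∑ c, ∑ e, g i a j b c e := by
  refine Finset.sum_congr rfl fun i _ => ?_
  calc ∑ c, ∑ j, ∑ e, ∑ a, ∑ b, g i a j b c e
      = ∑ c, ∑ j, ∑ a, ∑ e, ∑ b, g i a j b c e :=
        Finset.sum_congr rfl fun c _ => Finset.sum_congr rfl fun j _ => Finset.sum_comm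
    _ = ∑ c, ∑ j, ∑ a, ∑ b, ∑ e, g i a j b c e :=
        Finset.sum_congr rfl fun c _ => Finset.sum_congr rfl fun j _ => Finset.sum_congr rfl fun a _ => Finset.sum_comm
    _ = ∑ c, ∑ a, ∑ j, ∑ b, ∑ e, g i a j b c e := Finset.sum_congr rfl fun c _ => Finset.sum_comm
    _ = ∑ a, ∑ c, ∑ j, ∑ b, ∑ e, g i a j b c e := Finset.sum_comm
    _ = ∑ a, ∑ j, ∑ c, ∑ b, ∑ e, g i a j b c e := Finset.sum_congr rfl fun a _ => Finset.sum_comm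
    _ = ∑ a, ∑ j, ∑ b, ∑ c, ∑ e, g i a j b c e :=
        Finset.sum_congr rfl fun a _ => Finset.sum_congr rfl fun j _ => Finset.sum_comm

omit [DecidableEq d] in
/-- **The transverse symbol of the conjugated tensor is the symbol at the twisted covector**:
`σ_{𝔸^{M}}(ξ, p) = σ_𝔸(Mᵀξ, p)` with `(Mᵀξ)_a = Σ_c M_{ca} ξ_c = (ξ ᵥ* M)_a`
(`(𝔸^M)_{icje} = Σ_{a,b} M_{ca} 𝔸_{iajb} M_{eb}`). [cite: ArmstrongVicol2025, §4.1 (PDF p. 34)]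
[cite: Giaquinta1983MultipleIntegrals, Ch. III §2 eq. (2.1)-(2.2)] -/
theorem symb_conj (M : Matrix d d ℝ) (𝔸 : Visc4 d) (ξ p : d → ℝ) :
    symb (Visc4.conj M 𝔸) ξ p = symb 𝔸 (Matrix.vecMul ξ M) p := by
  simp only [symb, Visc4.conj_apply, Matrix.vecMul, dotProduct]
  -- both sides are the same six-fold sum, summed in different orders
  have lhs : ∑ i, ∑ c, ∑ j, ∑ e, (∑ a, ∑ b, M c a * 𝔸 i a j b * M e b) * p i * ξ c * p j * ξ e =
      ∑ i, ∑ c, ∑ j, ∑ e, ∑ a, ∑ b, M c a * 𝔸 i a j b * M e b * p i * ξ c * p j * ξ e := by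
    simp only [Finset.sum_mul]
  have e1 : ∀ i a j b, 𝔸 i a j b * p i * (∑ c, ξ c * M c a) * p j * (∑ e, ξ e * M e b) =
      (𝔸 i a j b * p i * p j) * ((∑ c, ξ c * M c a) * (∑ e, ξ e * M e b)) := by
    intros; ring
  have rhs : ∑ i, ∑ a, ∑ j, ∑ b, 𝔸 i a j b * p i * (∑ c, ξ c * M c a) * p j * (∑ e, ξ e * M e b) =
      ∑ i, ∑ a, ∑ j, ∑ b, ∑ c, ∑ e, M c a * 𝔸 i a j b * M e b * p i * ξ c * p j * ξ e := by
    simp_rw [e1, Finset.sum_mul_sum, Finset.mul_sum]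
    exact Finset.sum_congr rfl fun i _ => Finset.sum_congr rfl fun a _ => Finset.sum_congr rfl fun j _ =>
      Finset.sum_congr rfl fun b _ => Finset.sum_congr rfl fun c _ => Finset.sum_congr rfl fun e _ => by ring
  rw [lhs, rhs]
  exact sum6_reindex (fun i a j b c e => M c a * 𝔸 i a j b * M e b * p i * ξ c * p j * ξ e)

omit [DecidableEq d] in
/-- **`Re ⟪z, T_{𝔸^{M}}(k) z⟫ = σ_𝔸(Mᵀk, Re z) + σ_𝔸(Mᵀk, Im z)`** (integer mode `k`, any real tensor).
[cite: Frisch1995Turbulence, §9.6.3 eq. (9.57) p. 233] [cite: ArmstrongVicol2025, §4.1 (PDF p. 34)] -/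
theorem re_inner_symbT_conj_eq (M : Matrix d d ℝ) (𝔸 : Visc4 d) (k : d → ℤ) (z : EuclideanSpace ℂ d) :
    (⟪z, symbT (Visc4.conj M 𝔸) k z⟫_ℂ).re =
      symb 𝔸 (twistFreq M k) (fun i => (z i).re) + symb 𝔸 (twistFreq M k) (fun i => (z i).im) := by
  rw [re_inner_symbT_eq, symb_conj, symb_conj, twistFreq_eq_vecMul]

omit [DecidableEq d] in
/-- `‖z‖² = Σ (Re zᵢ)² + Σ (Im zᵢ)²` on `ℂ^d`. [cite: Temam1984, Ch. III §1.1] -/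
theorem norm_sq_eq_sum_re_sq_add_sum_im_sq (z : EuclideanSpace ℂ d) :
    ‖z‖ ^ 2 = ∑ i, (z i).re ^ 2 + ∑ i, (z i).im ^ 2 := by
  rw [EuclideanSpace.norm_sq_eq, ← Finset.sum_add_distrib]
  refine Finset.sum_congr rfl fun i _ => ?_
  rw [Complex.sq_norm, Complex.normSq_apply]
  ring

omit [DecidableEq d] in
/-- **Coercivity of the conjugated symbol on the TWISTED plane**: `NearIso 𝔸 lo hi` and `(Mᵀk) · z = 0` give
`lo |Mᵀk|² ‖z‖² ≤ Re ⟪z, T_{𝔸^{M}}(k) z⟫_ℂ` (the Legendre–Hadamard lower window at the real covector `Mᵀk`).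
[cite: Giaquinta1983MultipleIntegrals, Ch. III §2 eq. (2.2)] [cite: ArmstrongVicol2025, §4.1 (PDF p. 34)] -/
theorem lo_mul_le_re_inner_symbT_conj {𝔸 : Visc4 d} {lo hi : ℝ} (h𝔸 : NearIso 𝔸 lo hi) (M : Matrix d d ℝ)
    {k : d → ℤ} {z : EuclideanSpace ℂ d} (hz : rdot (twistFreq M k) z = 0) :
    lo * ((∑ a, twistFreq M k a ^ 2) * ‖z‖ ^ 2) ≤ (⟪z, symbT (Visc4.conj M 𝔸) k z⟫_ℂ).re := by
  obtain ⟨hre, him⟩ := sum_re_mul_eq_zero_of_rdot_eq_zero hz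
  have h1 := (h𝔸 (twistFreq M k) (fun i => (z i).re) hre).1
  have h2 := (h𝔸 (twistFreq M k) (fun i => (z i).im) him).1
  rw [re_inner_symbT_conj_eq, norm_sq_eq_sum_re_sq_add_sum_im_sq]
  nlinarith [h1, h2]

omit [DecidableEq d] in
/-- **Upper window of the conjugated symbol on the twisted plane**: `NearIso 𝔸 lo hi` and `(Mᵀk) · z = 0` give
`Re ⟪z, T_{𝔸^{M}}(k) z⟫_ℂ ≤ hi |Mᵀk|² ‖z‖²`. [cite: Giaquinta1983MultipleIntegrals, Ch. III §2 eq. (2.2)]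
[cite: ArmstrongVicol2025, §4.1 (PDF p. 34)] -/
theorem re_inner_symbT_conj_le {𝔸 : Visc4 d} {lo hi : ℝ} (h𝔸 : NearIso 𝔸 lo hi) (M : Matrix d d ℝ)
    {k : d → ℤ} {z : EuclideanSpace ℂ d} (hz : rdot (twistFreq M k) z = 0) :
    (⟪z, symbT (Visc4.conj M 𝔸) k z⟫_ℂ).re ≤ hi * ((∑ a, twistFreq M k a ^ 2) * ‖z‖ ^ 2) := by
  obtain ⟨hre, him⟩ := sum_re_mul_eq_zero_of_rdot_eq_zero hz
  have h1 := (h𝔸 (twistFreq M k) (fun i => (z i).re) hre).2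
  have h2 := (h𝔸 (twistFreq M k) (fun i => (z i).im) him).2
  rw [re_inner_symbT_conj_eq, norm_sq_eq_sum_re_sq_add_sum_im_sq]
  nlinarith [h1, h2]

/-- The identity frame: `𝔸^{1} = 𝔸`, `twistFreq 1 k = k`, so the two bounds above contain the integer-file
coercivity `lo_mul_le_re_inner_symbT` (consistency check). [cite: Giaquinta1983MultipleIntegrals, Ch. III §2 eq. (2.2)] -/
theorem lo_mul_le_re_inner_symbT_of_conj_one {𝔸 : Visc4 d} {lo hi : ℝ} (h𝔸 : NearIso 𝔸 lo hi)
    {k : d → ℤ} {z : EuclideanSpace ℂ d} (hz : rdot (fun j => (k j : ℝ)) z = 0) :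
    lo * (FunctionSpaces.Torus.freqNormSq k * ‖z‖ ^ 2) ≤ (⟪z, symbT 𝔸 k z⟫_ℂ).re := by
  have h := lo_mul_le_re_inner_symbT_conj h𝔸 (1 : Matrix d d ℝ) (k := k) (z := z) (by rwa [twistFreq_one])
  rw [Visc4.conj_one, twistFreq_one] at h
  rw [FunctionSpaces.Torus.freqNormSq]
  exact h

end Torus

end Literature.Analysis.FluidPDE

end
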